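import Literature.AnabelianGeometry.AbsoluteAnabelian.AbsTopI.CoFreeCompletion
import HarnessLib

/-!
# [AbsTopI] §0 p. 8 / Prop 4.10 (iii): comparison of two co-free completions with respect to the
# SAME profinite quotient `Q` — the algebra behind "(iii) follows immediately from (i)" (p. 61)

S. Mochizuki, *Topics in Absolute Anabelian Geometry I: Generalities* [AbsTopI] (J. Math. Sci.
Univ. Tokyo 19 (2012)), §0 p. 8 (the `(Q, Δ)`-co-free completion
`Π^{Q/co-fr} := lim_H Im_Q(Π/H^{co-fr})`) and Prop 4.10 (iii) p. 60 with its proof p. 61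
"Assertion (iii) follows immediately from assertion (i)" (manuscript pagination, lit key
`paper:url-11ac98ba15fc`, read on the page).  In (iii) one compares, inside the same `Q = Π̂^tp_Y`,
the co-free completion of `Π^tp_X` (along `f̂ ∘ toHat_X`, indices `H ⊆ Δ^tp_X`) with that of `Π^tp_Y`
(along `toHat_Y`, indices `H′ ⊆ Δ^tp_Y`; `≅ Π^tp_Y` by (i)).  This file isolates the GROUP-THEORETIC
mechanism, for the REAL construction `CoFreeCompletion` (abc-iut-L4-t13, v2 topology):

Given `ρX : Π_X → Q`, `ρY : Π_Y → Q`, `f : Π_X → Π_Y` with `ρY ∘ f = ρX`, and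
* a refinement choice `c : I_Y → I_X` with `X̂-kernel(c H′) ≤ Ŷ-kernel(H′)` (cofinality, one
  direction — at the intended data: row `CoFreeCofinalImAlong` conjunct 2 of
  `AbsTopIProp410CoFreeBridge.lean`),
we construct the comparison homomorphism `compareHom : Π_X^{Q/co-fr} → Π_Y^{Q/co-fr}`
(`[q]_{c H′} ↦ [q]_{H′}`), INDEPENDENT of the choice `c` (`val_qmap_indep`), natural
(`compareHom_toCoFreeCompletion : compare (η_X p) = η_Y (f p)`) and CONTINUOUS for the v2
topologies (`continuous_compareHom`); given moreover
* a converse refinement `d : I_X → I_Y` with `Ŷ-kernel(d H) ≤ X̂-kernel(H)` (conjunct 1), it is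
  INJECTIVE (`compareHom_injective`), and given
* IMAGE AGREEMENT `∀ H q, ∃ p, [ρY q] = [ρX p]` in `Q ⧸ X̂-kernel(H)` (the honest residue of row
  iii.L03: "surjectivity of `f` modulo the co-free kernels", strictly weaker than surjectivity),
  it is SURJECTIVE (`compareHom_surjective`).
So the two completions are canonically isomorphic as abstract groups compatibly with `η` and `f`;
composed with (i) for `Y` this is the isomorphism "(Π^tp_X)^{Π̂_Y/co-fr} ≅ Π^tp_Y` carrying `η` to
`f`" of (iii) at the level of groups (the homeomorphism upgrade needs an openness input; separate
file).  HONEST FRAMING: general group theory/topology; the rows it consumes are named hypotheses;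
nothing here bears on [IUTchIII] Cor 3.12.
-/

noncomputable section

open Topology

universe u u' v

namespace Literature.AnabelianGeometry.AbsoluteAnabelian.AbsTopI

/-! ### Maps `Q/N₁ → Q/N₂` induced by the identity -/

section QMap

variable {Q : Type v} [Group Q]

/-- `Q ⧸ N₁ → Q ⧸ N₂` for `N₁ ≤ N₂`, induced by the identity of `Q`. [cite: MochizukiAbsTopI2012, §0 p.8] -/
def qmap {N₁ N₂ : Subgroup Q} [N₁.Normal] [N₂.Normal] (h : N₁ ≤ N₂) : Q ⧸ N₁ →* Q ⧸ N₂ :=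
  QuotientGroup.map N₁ N₂ (MonoidHom.id Q) h

/-- `qmap` on classes. [cite: MochizukiAbsTopI2012, §0 p.8] -/
@[simp] theorem qmap_mk {N₁ N₂ : Subgroup Q} [N₁.Normal] [N₂.Normal] (h : N₁ ≤ N₂) (q : Q) :
    qmap h (q : Q ⧸ N₁) = (q : Q ⧸ N₂) := rfl

/-- `qmap`s compose to a `qmap`. [cite: MochizukiAbsTopI2012, §0 p.8] -/
theorem qmap_qmap {N₁ N₂ N₃ : Subgroup Q} [N₁.Normal] [N₂.Normal] [N₃.Normal] (h₁₂ : N₁ ≤ N₂)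
    (h₂₃ : N₂ ≤ N₃) (y : Q ⧸ N₁) : qmap h₂₃ (qmap h₁₂ y) = qmap (h₁₂.trans h₂₃) y := by
  obtain ⟨q, rfl⟩ := QuotientGroup.mk_surjective y
  rw [qmap_mk, qmap_mk, qmap_mk]

/-- `qmap` along `N ≤ N` is the identity. [cite: MochizukiAbsTopI2012, §0 p.8] -/
theorem qmap_refl {N : Subgroup Q} [N.Normal] (y : Q ⧸ N) : qmap (le_refl N) y = y := by
  obtain ⟨q, rfl⟩ := QuotientGroup.mk_surjective y
  rw [qmap_mk]

variable [TopologicalSpace Q] [IsTopologicalGroup Q] {P : Type u} [Group P] [TopologicalSpace P]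
  (ρ : P →ₜ* Q) {Δ : Subgroup P}

/-- The transition maps of the co-free completion are `qmap`s. [cite: MochizukiAbsTopI2012, §0 p.8] -/
theorem transition_eq_qmap {H H' : Subgroup P} (h : H' ≤ H) (y : CoFreeQuot ρ H') :
    transition ρ h y = qmap (coFreeKernel_mono ρ h) y := by
  obtain ⟨q, rfl⟩ := QuotientGroup.mk_surjective y
  rw [transition_mk, qmap_mk]

variable {ρ}

/-- **Independence of the refining index**: pushing the coordinates `x_{H₁}`, `x_{H₂}` of a point of
the completion into a common quotient `Q ⧸ N′` (`N_{H₁}, N_{H₂} ≤ N′`) gives the same class — both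
equal the push of `x_{H₁ ⊓ H₂}`. [cite: MochizukiAbsTopI2012, §0 p.8] -/
theorem CoFreeCompletion.val_qmap_indep (x : CoFreeCompletion ρ Δ) {N' : Subgroup Q} [N'.Normal]
    {H₁ H₂ : CharOpenSubgroup Δ} (h₁ : coFreeKernel ρ H₁.toSubgroup ≤ N')
    (h₂ : coFreeKernel ρ H₂.toSubgroup ≤ N') : qmap h₁ (x.val H₁) = qmap h₂ (x.val H₂) := by
  rw [← x.transition_val (inf_le_left : H₁ ⊓ H₂ ≤ H₁),
    ← x.transition_val (inf_le_right : H₁ ⊓ H₂ ≤ H₂), transition_eq_qmap, transition_eq_qmap,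
    qmap_qmap, qmap_qmap]

end QMap

/-! ### The comparison homomorphism -/

section Compare

variable {PX : Type u} [Group PX] [TopologicalSpace PX] {PY : Type u'} [Group PY]
  [TopologicalSpace PY] {Q : Type v} [Group Q] [TopologicalSpace Q] [IsTopologicalGroup Q]
  {ρX : PX →ₜ* Q} {ρY : PY →ₜ* Q} {ΔX : Subgroup PX} {ΔY : Subgroup PY} {f : PX →ₜ* PY}

/-- The coordinates of the comparison map: `x ↦ ([x_{c H′}] pushed to Q ⧸ N′_{H′})_{H′}`, for a
refinement choice `c`. [cite: MochizukiAbsTopI2012, §0 p.8] -/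
def compareVal (c : CharOpenSubgroup ΔY → CharOpenSubgroup ΔX)
    (hc : ∀ H', coFreeKernel ρX (c H').toSubgroup ≤ coFreeKernel ρY H'.toSubgroup)
    (x : CoFreeCompletion ρX ΔX) (H' : CharOpenSubgroup ΔY) : CoFreeQuot ρY H'.toSubgroup :=
  qmap (hc H') (x.val (c H'))

/-- The comparison coordinates do not depend on the refinement choice. [cite: MochizukiAbsTopI2012, §0 p.8] -/
theorem compareVal_eq_qmap (c : CharOpenSubgroup ΔY → CharOpenSubgroup ΔX)
    (hc : ∀ H', coFreeKernel ρX (c H').toSubgroup ≤ coFreeKernel ρY H'.toSubgroup)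
    (x : CoFreeCompletion ρX ΔX) (H' : CharOpenSubgroup ΔY) {H : CharOpenSubgroup ΔX}
    (h : coFreeKernel ρX H.toSubgroup ≤ coFreeKernel ρY H'.toSubgroup) :
    compareVal c hc x H' = qmap h (x.val H) :=
  x.val_qmap_indep (hc H') h

/-- A representative: if `x_{c H′} = [ρX p]` then the `H′`-coordinate of the comparison is
`[ρY (f p)]` (compatibility `ρY ∘ f = ρX`). [cite: MochizukiAbsTopI2012, §0 p.8] -/
theorem compareVal_eq_toCoFreeQuot (hf : ∀ p, ρY (f p) = ρX p)
    (c : CharOpenSubgroup ΔY → CharOpenSubgroup ΔX)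
    (hc : ∀ H', coFreeKernel ρX (c H').toSubgroup ≤ coFreeKernel ρY H'.toSubgroup)
    (x : CoFreeCompletion ρX ΔX) (H' : CharOpenSubgroup ΔY) {p : PX}
    (hp : toCoFreeQuot ρX (c H').toSubgroup p = x.val (c H')) :
    compareVal c hc x H' = toCoFreeQuot ρY H'.toSubgroup (f p) := by
  rw [compareVal, ← hp, toCoFreeQuot_apply, toCoFreeQuot_apply, qmap_mk, hf]

variable (f)

/-- **The comparison homomorphism `Π_X^{Q/co-fr} → Π_Y^{Q/co-fr}`** along `f` (with `ρY ∘ f = ρX`)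
for a refinement choice `c` — the map implicit in "(iii) follows immediately from (i)"
([AbsTopI] p. 61). [cite: MochizukiAbsTopI2012, Prop 4.10 (iii) p.60] -/
def compareHom (hf : ∀ p, ρY (f p) = ρX p) (c : CharOpenSubgroup ΔY → CharOpenSubgroup ΔX)
    (hc : ∀ H', coFreeKernel ρX (c H').toSubgroup ≤ coFreeKernel ρY H'.toSubgroup) :
    CoFreeCompletion ρX ΔX →* CoFreeCompletion ρY ΔY where
  toFun x := ⟨compareVal c hc x,
    fun H'₁ H'₂ h => by
      rw [transition_eq_qmap, compareVal, qmap_qmap]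
      exact (compareVal_eq_qmap c hc x H'₁ _).symm,
    fun H' => by
      obtain ⟨p, hp⟩ := x.exists_toCoFreeQuot_eq_val (c H')
      exact ⟨f p, (compareVal_eq_toCoFreeQuot hf c hc x H' hp).symm⟩⟩
  map_one' := by
    apply Subtype.ext
    funext H'
    exact map_one (qmap (hc H'))
  map_mul' x y := by
    apply Subtype.ext
    funext H'
    exact map_mul (qmap (hc H')) (x.val (c H')) (y.val (c H'))

variable {f}

/-- Coordinates of the comparison homomorphism. [cite: MochizukiAbsTopI2012, Prop 4.10 (iii) p.60] -/
@[simp] theorem val_compareHom (hf : ∀ p, ρY (f p) = ρX p)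
    (c : CharOpenSubgroup ΔY → CharOpenSubgroup ΔX)
    (hc : ∀ H', coFreeKernel ρX (c H').toSubgroup ≤ coFreeKernel ρY H'.toSubgroup)
    (x : CoFreeCompletion ρX ΔX) (H' : CharOpenSubgroup ΔY) :
    (compareHom f hf c hc x).val H' = qmap (hc H') (x.val (c H')) := rfl

/-- The comparison homomorphism does not depend on the refinement choice.
[cite: MochizukiAbsTopI2012, Prop 4.10 (iii) p.60] -/
theorem compareHom_indep (hf : ∀ p, ρY (f p) = ρX p)
    (c₁ c₂ : CharOpenSubgroup ΔY → CharOpenSubgroup ΔX)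
    (hc₁ : ∀ H', coFreeKernel ρX (c₁ H').toSubgroup ≤ coFreeKernel ρY H'.toSubgroup)
    (hc₂ : ∀ H', coFreeKernel ρX (c₂ H').toSubgroup ≤ coFreeKernel ρY H'.toSubgroup)
    (x : CoFreeCompletion ρX ΔX) : compareHom f hf c₁ hc₁ x = compareHom f hf c₂ hc₂ x :=
  CoFreeCompletion.ext fun H' => x.val_qmap_indep (hc₁ H') (hc₂ H')

/-- **Naturality**: the comparison carries `η_X(p)` to `η_Y(f p)` — it "is" `f` on the dense images.
[cite: MochizukiAbsTopI2012, Prop 4.10 (iii) p.60] -/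
theorem compareHom_toCoFreeCompletion (hf : ∀ p, ρY (f p) = ρX p)
    (c : CharOpenSubgroup ΔY → CharOpenSubgroup ΔX)
    (hc : ∀ H', coFreeKernel ρX (c H').toSubgroup ≤ coFreeKernel ρY H'.toSubgroup) (p : PX) :
    compareHom f hf c hc (toCoFreeCompletion ρX ΔX p) = toCoFreeCompletion ρY ΔY (f p) := by
  apply CoFreeCompletion.ext
  intro H'
  rw [val_compareHom, val_toCoFreeCompletion]
  exact compareVal_eq_toCoFreeQuot hf c hc (toCoFreeCompletion ρX ΔX p) H'
    (val_toCoFreeCompletion ρX ΔX p (c H')).symm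

/-! ### Continuity (v2 topologies: inverse limits of the quotient topologies `Π ⧸ K_H`) -/

/-- `K_{c H′} ⊆ f⁻¹(K′_{H′})`: `f` descends to `Π_X ⧸ K_{c H′} → Π_Y ⧸ K′_{H′}`.
[cite: MochizukiAbsTopI2012, Prop 4.10 (iii) p.60] -/
theorem piKer_le_comap (hf : ∀ p, ρY (f p) = ρX p)
    (c : CharOpenSubgroup ΔY → CharOpenSubgroup ΔX)
    (hc : ∀ H', coFreeKernel ρX (c H').toSubgroup ≤ coFreeKernel ρY H'.toSubgroup)
    (H' : CharOpenSubgroup ΔY) :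
    CoFreeCompletion.piKer ρX ΔX (c H') ≤ (CoFreeCompletion.piKer ρY ΔY H').comap f.toMonoidHom := by
  intro p hp
  rw [Subgroup.mem_comap, MonoidHom.mem_ker]
  rw [MonoidHom.mem_ker] at hp
  change ((ρY (f p) : Q) : CoFreeQuot ρY H'.toSubgroup) = 1
  change ((ρX p : Q) : CoFreeQuot ρX (c H').toSubgroup) = 1 at hp
  rw [QuotientGroup.eq_one_iff] at hp ⊢
  rw [hf]
  exact hc H' hp

/-- The descended map `Π_X ⧸ K_{c H′} → Π_Y ⧸ K′_{H′}`. [cite: MochizukiAbsTopI2012, Prop 4.10 (iii) p.60] -/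
def kerMap (hf : ∀ p, ρY (f p) = ρX p) (c : CharOpenSubgroup ΔY → CharOpenSubgroup ΔX)
    (hc : ∀ H', coFreeKernel ρX (c H').toSubgroup ≤ coFreeKernel ρY H'.toSubgroup)
    (H' : CharOpenSubgroup ΔY) :
    PX ⧸ CoFreeCompletion.piKer ρX ΔX (c H') →* PY ⧸ CoFreeCompletion.piKer ρY ΔY H' :=
  QuotientGroup.map _ _ f.toMonoidHom (piKer_le_comap hf c hc H')

/-- The `Π_Y ⧸ K′_{H′}`-coordinate of the comparison is the descended `f` applied to the
`Π_X ⧸ K_{c H′}`-coordinate. [cite: MochizukiAbsTopI2012, Prop 4.10 (iii) p.60] -/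
theorem kerCoord_compareHom (hf : ∀ p, ρY (f p) = ρX p)
    (c : CharOpenSubgroup ΔY → CharOpenSubgroup ΔX)
    (hc : ∀ H', coFreeKernel ρX (c H').toSubgroup ≤ coFreeKernel ρY H'.toSubgroup)
    (x : CoFreeCompletion ρX ΔX) (H' : CharOpenSubgroup ΔY) :
    CoFreeCompletion.kerCoord H' (compareHom f hf c hc x) =
      kerMap hf c hc H' (CoFreeCompletion.kerCoord (c H') x) := by
  obtain ⟨p, hp⟩ := x.exists_toCoFreeQuot_eq_val (c H')
  rw [CoFreeCompletion.kerCoord_eq_mk hp, kerMap, QuotientGroup.map_mk]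
  apply CoFreeCompletion.kerCoord_eq_mk
  rw [val_compareHom]
  exact (compareVal_eq_toCoFreeQuot hf c hc x H' hp).symm

variable [IsTopologicalGroup PX]

/-- The descended map is continuous (quotient topologies). [cite: MochizukiAbsTopI2012, Prop 4.10 (iii) p.60] -/
theorem continuous_kerMap (hf : ∀ p, ρY (f p) = ρX p)
    (c : CharOpenSubgroup ΔY → CharOpenSubgroup ΔX)
    (hc : ∀ H', coFreeKernel ρX (c H').toSubgroup ≤ coFreeKernel ρY H'.toSubgroup)
    (H' : CharOpenSubgroup ΔY) : Continuous (kerMap hf c hc H') := by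
  apply (QuotientGroup.isOpenQuotientMap_mk
    (N := CoFreeCompletion.piKer ρX ΔX (c H'))).continuous_comp_iff.mp
  exact QuotientGroup.continuous_mk.comp f.continuous

/-- **The comparison homomorphism is continuous** for the v2 (inverse-limit-of-quotient) topologies.
[cite: MochizukiAbsTopI2012, Prop 4.10 (iii) p.60] -/
theorem continuous_compareHom (hf : ∀ p, ρY (f p) = ρX p)
    (c : CharOpenSubgroup ΔY → CharOpenSubgroup ΔX)
    (hc : ∀ H', coFreeKernel ρX (c H').toSubgroup ≤ coFreeKernel ρY H'.toSubgroup) :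
    Continuous (compareHom f hf c hc) := by
  rw [CoFreeCompletion.continuous_iff_kerCoord]
  intro H'
  have h : (fun x => CoFreeCompletion.kerCoord H' (compareHom f hf c hc x)) =
      kerMap hf c hc H' ∘ CoFreeCompletion.kerCoord (c H') :=
    funext fun x => kerCoord_compareHom hf c hc x H'
  rw [h]
  exact (continuous_kerMap hf c hc H').comp (CoFreeCompletion.continuous_kerCoord (c H'))

variable (f) in
/-- The comparison as a CONTINUOUS homomorphism `Π_X^{Q/co-fr} →ₜ* Π_Y^{Q/co-fr}`.
[cite: MochizukiAbsTopI2012, Prop 4.10 (iii) p.60] -/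
def compare (hf : ∀ p, ρY (f p) = ρX p) (c : CharOpenSubgroup ΔY → CharOpenSubgroup ΔX)
    (hc : ∀ H', coFreeKernel ρX (c H').toSubgroup ≤ coFreeKernel ρY H'.toSubgroup) :
    CoFreeCompletion ρX ΔX →ₜ* CoFreeCompletion ρY ΔY :=
  { compareHom f hf c hc with continuous_toFun := continuous_compareHom hf c hc }

/-- `compare` is `compareHom`. [cite: MochizukiAbsTopI2012, Prop 4.10 (iii) p.60] -/
@[simp] theorem compare_apply (hf : ∀ p, ρY (f p) = ρX p)
    (c : CharOpenSubgroup ΔY → CharOpenSubgroup ΔX)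
    (hc : ∀ H', coFreeKernel ρX (c H').toSubgroup ≤ coFreeKernel ρY H'.toSubgroup)
    (x : CoFreeCompletion ρX ΔX) : compare f hf c hc x = compareHom f hf c hc x := rfl

end Compare

/-! ### Injectivity from the converse cofinality; surjectivity from image agreement -/

section Bijective

variable {PX : Type u} [Group PX] [TopologicalSpace PX] {PY : Type u'} [Group PY]
  [TopologicalSpace PY] {Q : Type v} [Group Q] [TopologicalSpace Q] [IsTopologicalGroup Q]
  {ρX : PX →ₜ* Q} {ρY : PY →ₜ* Q} {ΔX : Subgroup PX} {ΔY : Subgroup PY} {f : PX →ₜ* PY}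

/-- **Injectivity** of the comparison from the CONVERSE cofinality (a choice `d : I_X → I_Y` with
`Ŷ-kernel(d H) ≤ X̂-kernel(H)`; at the intended data: `CoFreeCofinalImAlong` conjunct 1).
[cite: MochizukiAbsTopI2012, Prop 4.10 (iii) p.60] -/
theorem compareHom_injective (hf : ∀ p, ρY (f p) = ρX p)
    (c : CharOpenSubgroup ΔY → CharOpenSubgroup ΔX)
    (hc : ∀ H', coFreeKernel ρX (c H').toSubgroup ≤ coFreeKernel ρY H'.toSubgroup)
    (d : CharOpenSubgroup ΔX → CharOpenSubgroup ΔY)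
    (hd : ∀ H, coFreeKernel ρY (d H).toSubgroup ≤ coFreeKernel ρX H.toSubgroup) :
    Function.Injective (compareHom f hf c hc) := by
  rw [injective_iff_map_eq_one]
  intro x hx
  apply CoFreeCompletion.ext
  intro H
  -- `x_H` is the push of `x_{H₀}`, `H₀ := c (d H) ⊓ H`, through `Q ⧸ N'_{d H}`, where it is the
  -- `(d H)`-coordinate of `compare x = 1`
  have hval : (compareHom f hf c hc x).val (d H) = 1 := by rw [hx]; rfl
  have h0 : coFreeKernel ρX (c (d H) ⊓ H).toSubgroup ≤ coFreeKernel ρY (d H).toSubgroup :=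
    (coFreeKernel_mono ρX (show (c (d H) ⊓ H).toSubgroup ≤ (c (d H)).toSubgroup from
      inf_le_left)).trans (hc (d H))
  rw [val_compareHom, ← x.val_qmap_indep h0 (hc (d H))] at hval
  change x.val H = (1 : CoFreeCompletion ρX ΔX).val H
  rw [← x.transition_val (inf_le_right : c (d H) ⊓ H ≤ H), transition_eq_qmap,
    ← qmap_qmap h0 (hd H), hval, map_one]
  rfl

/-- **Surjectivity** of the comparison from the converse cofinality together with IMAGE AGREEMENT
(`∀ H q, ∃ p, [ρY q] = [ρX p]` in `Q ⧸ X̂-kernel(H)` — "`Π_Y = f(Π_X)` modulo the co-free kernels",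
the honest residue of row iii.L03). [cite: MochizukiAbsTopI2012, Prop 4.10 (iii) p.60] -/
theorem compareHom_surjective (hf : ∀ p, ρY (f p) = ρX p)
    (c : CharOpenSubgroup ΔY → CharOpenSubgroup ΔX)
    (hc : ∀ H', coFreeKernel ρX (c H').toSubgroup ≤ coFreeKernel ρY H'.toSubgroup)
    (d : CharOpenSubgroup ΔX → CharOpenSubgroup ΔY)
    (hd : ∀ H, coFreeKernel ρY (d H).toSubgroup ≤ coFreeKernel ρX H.toSubgroup)
    (hIA : ∀ (H : CharOpenSubgroup ΔX) (q : PY), ∃ p : PX,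
      ((ρY q : Q) : CoFreeQuot ρX H.toSubgroup) = toCoFreeQuot ρX H.toSubgroup p) :
    Function.Surjective (compareHom f hf c hc) := by
  intro y
  -- the candidate preimage: `x_H := push of y_{d H}`
  let xv : ∀ H : CharOpenSubgroup ΔX, CoFreeQuot ρX H.toSubgroup :=
    fun H => qmap (hd H) (y.val (d H))
  have hcompat : ∀ (H₁ H₂ : CharOpenSubgroup ΔX) (h : H₂ ≤ H₁), transition ρX h (xv H₂) = xv H₁ := by
    intro H₁ H₂ h
    change transition ρX h (qmap (hd H₂) (y.val (d H₂))) = qmap (hd H₁) (y.val (d H₁))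
    rw [transition_eq_qmap, qmap_qmap]
    exact y.val_qmap_indep _ _
  have himage : ∀ H : CharOpenSubgroup ΔX, xv H ∈ imageInQuot ρX H.toSubgroup := by
    intro H
    obtain ⟨q, hq⟩ := y.exists_toCoFreeQuot_eq_val (d H)
    obtain ⟨p, hp⟩ := hIA H q
    refine ⟨p, ?_⟩
    change toCoFreeQuot ρX H.toSubgroup p = qmap (hd H) (y.val (d H))
    rw [← hp, ← hq, toCoFreeQuot_apply, qmap_mk]
  refine ⟨⟨xv, hcompat, himage⟩, ?_⟩
  apply CoFreeCompletion.ext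
  intro H'
  rw [val_compareHom]
  change qmap (hc H') (qmap (hd (c H')) (y.val (d (c H')))) = y.val H'
  rw [qmap_qmap, ← qmap_refl (y.val H')]
  exact y.val_qmap_indep _ _

/-- Under both cofinality choices and image agreement the comparison is a BIJECTIVE homomorphism
compatible with `η` and `f`: the two completions are canonically isomorphic as groups.
[cite: MochizukiAbsTopI2012, Prop 4.10 (iii) p.60] -/
theorem compareHom_bijective (hf : ∀ p, ρY (f p) = ρX p)
    (c : CharOpenSubgroup ΔY → CharOpenSubgroup ΔX)
    (hc : ∀ H', coFreeKernel ρX (c H').toSubgroup ≤ coFreeKernel ρY H'.toSubgroup)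
    (d : CharOpenSubgroup ΔX → CharOpenSubgroup ΔY)
    (hd : ∀ H, coFreeKernel ρY (d H).toSubgroup ≤ coFreeKernel ρX H.toSubgroup)
    (hIA : ∀ (H : CharOpenSubgroup ΔX) (q : PY), ∃ p : PX,
      ((ρY q : Q) : CoFreeQuot ρX H.toSubgroup) = toCoFreeQuot ρX H.toSubgroup p) :
    Function.Bijective (compareHom f hf c hc) :=
  ⟨compareHom_injective hf c hc d hd, compareHom_surjective hf c hc d hd hIA⟩

end Bijective

end Literature.AnabelianGeometry.AbsoluteAnabelian.AbsTopI
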